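import Summits.NavierStokesRegularity.NavierStokesRegularity.Theorems.RecurrentProfilesRecurrentLiouvilleClockAdjointPairing
import Summits.NavierStokesRegularity.NavierStokesRegularity.Theorems.RecurrentProfilesRecurrentLiouvilleClockAdjointMass
import Summits.NavierStokesRegularity.NavierStokesRegularity.Theorems.RecurrentProfilesRecurrentLiouvilleClockFluxDuality
import Summits.NavierStokesRegularity.NavierStokesRegularity.Theorems.RecurrentProfilesRecurrentLiouvilleClockFluxTools
import Summits.NavierStokesRegularity.NavierStokesRegularity.Theorems.RecurrentProfilesRecurrentLiouvilleClockWindowPackage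
import Summits.NavierStokesRegularity.NavierStokesRegularity.Theorems.RecurrentProfilesRecurrentLiouvilleClockKeepsClock
import Literature.Analysis.FluidPDE.ElgindiBlowup
import HarnessLib

/-!
# Crux `RecurrentLiouville` (stmt-NavierStokesRegularity-1589), line `Sketch` (ideator 4, stretching
# clock) — stub `stub_clockFluxDualityLaw`: the flux duality law (the card's K3, hypothesis-explicit)

Theorems-only file.  **Main result** (`stub_clockFluxDualityLaw`, registered): let `(u, q)` be a
classical Navier–Stokes solution (`ν = 1`, `f = 0`) on a window `[t₀, t₁]` with `u` and its spatial
derivatives of orders `≤ 3` bounded, `η` an ADJOINT TEST FIELD of `u` on the window (jointly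
smooth, uniformly rapidly decaying, `∂ₜη + Δη + (u·∇)η + (∇u)ᵀη = 0`), and `Λ ≥ 0` a bounded,
jointly continuous majorant of the strain form (`⟪∇u ξ, ξ⟫ ≤ Λ‖ξ‖²`).  If `‖ω(t₀, ·)‖ ≤ A₀`
(`ω = curl u`) and the terminal flux pairing `P = ∫⟪ω(t₁), η(t₁)⟫` is non-zero, then

`log( |P| / (A₀ ‖η(t₁)‖₁) ) ≤ ∫_{t₀}^{t₁} (∫ Λ|η(t)|) / ‖η(t)‖₁ dt` :

the `|η|`-WEIGHTED, time-integrated strain pays for the amplification that the conserved pairing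
transports across the window (Helmholtz duality `stub_clockAdjointPairing` + Kato's mass inequality
`stub_clockAdjointMass` + backward Grönwall `stub_clockFluxDuality`).  No existence theorem for the
backward adjoint Cauchy problem is needed: the adjoint field is given.  On Type-I ancient mild
windows (`fluxDualityLaw_typeI`) the classical package is automatic and `A₀ = K₁/(−t₀)` is the
gauge pin; with an adjoint field aimed at a near-maximiser of `|ω(t₁)|` on a singular profile
(`|P| ≥ θκ‖η(t₁)‖₁/(−t₁)`, floor `κ` of `stub_clockVorticityFloor`) the left side is
`log(t₀/t₁) − log(K₁/(θκ))` — the card's flux-weighted stretching-clock law K3.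

## References

* P. Constantin, Comm. Math. Phys. 129 (1990) 241–266, (2.9); SIAM Review 36 (1994) 73–98.
* A. J. Majda, A. L. Bertozzi, *Vorticity and Incompressible Flow*, CUP 2002, §1.6, §2.4.
-/

noncomputable section

-- the sub-problem namespace repeats the summit name (D-0017 layout `Summit.<S>.<P>.Theorems`)
set_option linter.dupNamespace false

namespace Summit.NavierStokesRegularity.NavierStokesRegularity.Theorems

open MeasureTheory Set Function Filter Topology TopologicalSpace Metric
open Literature.Analysis Literature.Analysis.FluidPDE
open scoped NNReal ENNReal RealInnerProductSpace Laplacian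

/-- **Flux duality law** (registered stub `stub_clockFluxDualityLaw` of line `Sketch`; from K1
`stub_clockAdjointPairing`, K1′ `stub_clockAdjointMass` and the Grönwall bookkeeping
`stub_clockFluxDuality`, with the mass continuity/positivity tools `clockFD_*`).
[cite: Constantin1990, (2.9)] -/
theorem stub_clockFluxDualityLaw :
    ∀ (t₀ t₁ : ℝ), t₀ < t₁ →
      ∀ (u η : ℝ → EuclideanSpace ℝ (Fin 3) → EuclideanSpace ℝ (Fin 3))
        (q : ℝ → EuclideanSpace ℝ (Fin 3) → ℝ) (Λ : ℝ → EuclideanSpace ℝ (Fin 3) → ℝ) (A₀ : ℝ),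
      IsClassicalNSSolutionOn (Set.Icc t₀ t₁) 1 0 u q →
      (∃ B : ℝ, ∀ t ∈ Set.Icc t₀ t₁, ∀ x : EuclideanSpace ℝ (Fin 3),
        ‖u t x‖ ≤ B ∧ ‖fderiv ℝ (u t) x‖ ≤ B ∧ ‖iteratedFDeriv ℝ 2 (u t) x‖ ≤ B ∧
          ‖iteratedFDeriv ℝ 3 (u t) x‖ ≤ B) →
      IsSmoothSpaceTimeOn (Set.Icc t₀ t₁) η →
      HasUniformRapidDecayOn (Set.Icc t₀ t₁) η →
      (∀ t ∈ Set.Icc t₀ t₁, ∀ x : EuclideanSpace ℝ (Fin 3),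
        timeDerivWithin (Set.Icc t₀ t₁) η t x + (Δ (η t)) x + convect (u t) (η t) x
          + ContinuousLinearMap.adjoint (fderiv ℝ (u t) x) (η t x) = 0) →
      ContinuousOn (uncurry Λ) (Set.Icc t₀ t₁ ×ˢ univ) →
      (∃ B : ℝ, ∀ t ∈ Set.Icc t₀ t₁, ∀ x : EuclideanSpace ℝ (Fin 3), 0 ≤ Λ t x ∧ Λ t x ≤ B) →
      (∀ t ∈ Set.Icc t₀ t₁, ∀ (x ξ : EuclideanSpace ℝ (Fin 3)),
        ⟪fderiv ℝ (u t) x ξ, ξ⟫ ≤ Λ t x * ‖ξ‖ ^ 2) →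
      (∀ x, ‖curl (u t₀) x‖ ≤ A₀) →
      0 < |∫ x, ⟪curl (u t₁) x, η t₁ x⟫| →
      Real.log (|∫ x, ⟪curl (u t₁) x, η t₁ x⟫| / (A₀ * ∫ x, ‖η t₁ x‖)) ≤
        ∫ t in t₀..t₁, (∫ x, Λ t x * ‖η t x‖) / (∫ x, ‖η t x‖) := by
  intro t₀ t₁ h01 u η q Λ A₀ hcl hB hηs hηd hadj hΛc hΛb hmaj hω₀ hP
  have ht₀ : t₀ ∈ Set.Icc t₀ t₁ := left_mem_Icc.2 h01.le
  have hdiv : ∀ t ∈ Set.Icc t₀ t₁, VectorCalculus.IsDivFree (u t) := fun t ht => hcl.divFree t ht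
  obtain ⟨B, hBall⟩ := hB
  have hB' : ∃ B : ℝ, ∀ t ∈ Set.Icc t₀ t₁, ∀ x : EuclideanSpace ℝ (Fin 3),
      ‖u t x‖ ≤ B ∧ ‖fderiv ℝ (u t) x‖ ≤ B :=
    ⟨B, fun t ht x => ⟨(hBall t ht x).1, (hBall t ht x).2.1⟩⟩
  -- K1 and K1′
  have hK1 := stub_clockAdjointPairing t₀ t₁ h01 u q η hcl ⟨B, hBall⟩ hηs hηd hadj
  have hK1' := stub_clockAdjointMass t₀ t₁ h01 u η Λ hcl.smooth_velocity hdiv hB' hηs hηd hadj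
    hΛc hΛb hmaj
  -- continuity, nonnegativity and positivity of the masses
  have hm := clockFD_continuousOn_mass hηs hηd
  have hb := clockFD_continuousOn_weighted hηs hηd hΛc hΛb
  have hb0 : ∀ t ∈ Set.Icc t₀ t₁, 0 ≤ ∫ x, Λ t x * ‖η t x‖ := fun t ht =>
    integral_nonneg fun x => by
      obtain ⟨B₁, hB₁⟩ := hΛb
      exact mul_nonneg (hB₁ t ht x).1 (norm_nonneg _)
  have hcurl : ∀ t ∈ Set.Icc t₀ t₁, ∀ x, ‖curl (u t) x‖ ≤ 4 * B := fun t ht x =>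
    (norm_curl_le_four_mul (u t) x).trans (by gcongr; exact (hBall t ht x).2.1)
  have hm0 : ∀ t ∈ Set.Icc t₀ t₁, 0 < ∫ x, ‖η t x‖ := by
    intro t ht
    have hle := clockFD_abs_pairing_le hηs hηd ht (hcurl t ht)
    rw [hK1 t ht] at hle
    exact clockFD_mass_pos hle hP (integral_nonneg fun x => norm_nonneg _)
  have hω₀' : |∫ x, ⟪curl (u t₀) x, η t₀ x⟫| ≤ A₀ * ∫ x, ‖η t₀ x‖ :=
    clockFD_abs_pairing_le hηs hηd ht₀ hω₀
  exact stub_clockFluxDuality t₀ t₁ h01 (fun t => ∫ x, ‖η t x‖) (fun t => ∫ x, Λ t x * ‖η t x‖)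
    (fun t => ∫ x, ⟪curl (u t) x, η t x⟫) A₀ hm hb hb0 hm0 hK1 hω₀' hK1' hP

/-- **Flux duality law on Type-I ancient mild windows** (class-level form): for `v ∈ A_C`, a window
`t₀ < t₁ < 0`, an adjoint test field `η` of `v` on the window and a bounded continuous majorant
`Λ ≥ 0` of the strain form, a non-degenerate terminal pairing is paid for by the `|η|`-weighted
strain, with the gauge pin `K₁/(−t₀)` as `A₀` (the classical window package is automatic:
`clockWP_classical`, `clockWP_bounds`). -/
theorem fluxDualityLaw_typeI
    {C : ℝ} {v η : ℝ → EuclideanSpace ℝ (Fin 3) → EuclideanSpace ℝ (Fin 3)}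
    (hv : IsTypeIAncientMild C v) {t₀ t₁ : ℝ} (h01 : t₀ < t₁) (h1 : t₁ < 0)
    {Λ : ℝ → EuclideanSpace ℝ (Fin 3) → ℝ}
    (hηs : IsSmoothSpaceTimeOn (Set.Icc t₀ t₁) η) (hηd : HasUniformRapidDecayOn (Set.Icc t₀ t₁) η)
    (hadj : ∀ t ∈ Set.Icc t₀ t₁, ∀ x : EuclideanSpace ℝ (Fin 3),
      timeDerivWithin (Set.Icc t₀ t₁) η t x + (Δ (η t)) x + convect (v t) (η t) x
        + ContinuousLinearMap.adjoint (fderiv ℝ (v t) x) (η t x) = 0)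
    (hΛc : ContinuousOn (uncurry Λ) (Set.Icc t₀ t₁ ×ˢ univ))
    (hΛb : ∃ B : ℝ, ∀ t ∈ Set.Icc t₀ t₁, ∀ x : EuclideanSpace ℝ (Fin 3), 0 ≤ Λ t x ∧ Λ t x ≤ B)
    (hmaj : ∀ t ∈ Set.Icc t₀ t₁, ∀ (x ξ : EuclideanSpace ℝ (Fin 3)),
      ⟪fderiv ℝ (v t) x ξ, ξ⟫ ≤ Λ t x * ‖ξ‖ ^ 2)
    (hP : 0 < |∫ x, ⟪curl (v t₁) x, η t₁ x⟫|) :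
    ∃ K₁ : ℝ, 0 < K₁ ∧
      Real.log (|∫ x, ⟪curl (v t₁) x, η t₁ x⟫| / (K₁ / (-t₀) * ∫ x, ‖η t₁ x‖)) ≤
        ∫ t in t₀..t₁, (∫ x, Λ t x * ‖η t x‖) / (∫ x, ‖η t x‖) := by
  obtain ⟨K₁, hK₁, hup⟩ := clockKC_upper_pin C
  obtain ⟨q, hcl⟩ := clockWP_classical hv h01 h1
  have hB := clockWP_bounds hv h01 h1
  exact ⟨K₁, hK₁, stub_clockFluxDualityLaw t₀ t₁ h01 v η q Λ (K₁ / (-t₀)) hcl hB hηs hηd hadj hΛc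
    hΛb hmaj (fun x => hup hv t₀ (h01.trans h1) x) hP⟩

end Summit.NavierStokesRegularity.NavierStokesRegularity.Theorems

end
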